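import Summits.CriticalPhenomena.Ising3DConformalLimit.Theorems.PrecisionLaplacianMoebiusLimitOfTwoPointLawExistenceAndInversion
import Summits.CriticalPhenomena.Ising3DConformalLimit.Theorems.PrecisionLaplacianMoebiusLimitOfTwoPointLawMeshReparametrisation
import Summits.CriticalPhenomena.Ising3DConformalLimit.Theorems.PrecisionLaplacianMoebiusLimitOfTwoPointLawInversionBegetsDilations
import Summits.CriticalPhenomena.Ising3DConformalLimit.Theorems.HyperoctahedralRPExistsScaleCovariantLimitDyadicLimitContinuous
import HarnessLib

/-!
# Crux `MoebiusLimitOfTwoPointLaw` (item stmt-CriticalPhenomena-4801) ⇔ DYADIC canonical convergence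
# + unit-inversion covariance of the dyadic limit (line `SketchIdeator5R2` = card
# `inversion-buys-the-filter`; the reduction and the two-factor split, `--supports stmt-CriticalPhenomena-4801`)

The landed third sharpening (`moebiusLimitOfTwoPointLaw_iff_existence_and_inversion`, p89954) reads:
the crux holds iff for every witness `(Δ, c)` of the two-point law (item 0634) there is a family `T`
whose even arities `n ≥ 4` are (a) the locally uniform limits of the canonically renormalised
correlators `δ^{-nΔ}⟨σ_{[x₁/δ]}⋯σ_{[xₙ/δ]}⟩_{β_c}` along the FULL filter `δ → 0⁺` off the diagonals
and (c) covariant under the unit inversion with weight `Δ`.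

This file replaces (a) by convergence along the SINGLE dyadic mesh sequence `δ_k = 2^{-k}`:

* `moebiusLimitOfTwoPointLaw_iff_dyadic` — **crux ⇔ ∀ (Δ,c) ⊨ 0634, ∃ T with (a₂) dyadic locally
  uniform canonical convergence of the even arities `n ≥ 4` and (c)**. Ingredients: translation
  invariance of sequential limits of `criticalCorr 3` is free (`seqLimit_translate`, landed);
  translations + `ι` give every dilation (`inversionBegetsDilations`, Lemma B) and all of `O(3)`
  (item 4675, used inside p89954); dyadic convergence + dilation covariance + the exact mesh identity
  give the full filter (`tendstoLocallyUniformlyOn_nhdsGT_of_dyadic`, Lemma A).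
* The two-factor split with the inversion factor quantified over ALL dyadic limits and asked only
  on `NonCoincident` (so that the two factors are independent statements):
  `D₂` = dyadic canonical limits of the even arities exist (arity by arity),
  `I₂` = every dyadic canonical limit of an even arity `n ≥ 4` is unit-inversion covariant with
  weight `Δ` at non-coincident configurations off the origin;
  `moebiusLimitOfTwoPointLaw_of_dyadic : D₂ → I₂ → crux` (the line's glue `MoebiusLimitOfTwoPointLaw_of`),
  `dyadicLimit_of_moebiusLimitOfTwoPointLaw : crux → D₂`,
  `dyadicInversion_of_moebiusLimitOfTwoPointLaw : crux → I₂` (uniqueness of pointwise limits), hence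
  `moebiusLimitOfTwoPointLaw_iff_dyadicLimit_and_dyadicInversion : crux ↔ D₂ ∧ I₂` — an EXACT
  factorisation with two factors, next to the landed three-factor residue
  `crux ↔ (0634 → 4738 ∧ 8367 ∧ 1982)` (p117654): no `O(3)` factor, and existence only along one
  mesh sequence with the canonical renormalisation.

Nothing Ising-specific is proved here beyond what the imports carry (lattice translations); `D₂`
(one-hierarchy existence, cf. items 4738/1981) and `I₂` (inversion covariance, cf. item 1982) are the
open mass of the crux. References: crux workfiles `Cruxes/MoebiusLimitOfTwoPointLaw/SketchIdeator5R2.lean`,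
`…/Disproof.lean` §1d/§1e, §5; Duminil-Copin ICM 2022 §8.4 (status on `ℤ³`). No definitions, no `sorry`.
-/

noncomputable section

namespace Summit.CriticalPhenomena.Ising3DConformalLimit.PrecisionLaplacianMoebiusLimitOfTwoPointLaw

open Literature.Probability.LatticeModels Filter Topology EuclideanGeometry
open Summit.CriticalPhenomena.Ising3DConformalLimit.Theses.PrecisionLaplacian (MoebiusLimitOfTwoPointLaw)
open Summit.CriticalPhenomena.Ising3DConformalLimit.Theorems.MoebiusLimitOfTwoPointLaw.Negative
  (truncate truncate_of_mem truncate_of_not_mem)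
open Summit.CriticalPhenomena.Ising3DConformalLimit.Cruxes.ExistsScaleCovariantLimit.TwoHierarchies
  (seqLimit_translate)

/-! ### Small tools -/

/-- `2^{-k} → 0⁺` within `(0, ∞)`. [folklore] -/
theorem tendsto_dyadicMesh : Tendsto (fun k : ℕ => ((2:ℝ) ^ k)⁻¹) atTop (𝓝[>] (0 : ℝ)) := by
  rw [tendsto_nhdsWithin_iff]
  refine ⟨?_, Eventually.of_forall fun k => Set.mem_Ioi.mpr (by positivity)⟩
  have h : Tendsto (fun k : ℕ => ((2:ℝ)⁻¹) ^ k) atTop (𝓝 0) :=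
    tendsto_pow_atTop_nhds_zero_of_lt_one (by norm_num) (by norm_num)
  exact h.congr fun k => by rw [inv_pow]

/-- Re-indexing a locally uniform limit along a sequence of parameters tending to the filter.
[folklore] -/
theorem tendstoLocallyUniformlyOn_comp_seq {α : Type*} [TopologicalSpace α] {F : ℝ → α → ℝ}
    {f : α → ℝ} {s : Set α} (h : TendstoLocallyUniformlyOn F f (𝓝[>] (0 : ℝ)) s) {u : ℕ → ℝ}
    (hu : Tendsto u atTop (𝓝[>] (0 : ℝ))) :
    TendstoLocallyUniformlyOn (fun k => F (u k)) f atTop s := by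
  intro w hw x hx
  obtain ⟨t, ht, hev⟩ := h w hw x hx
  exact ⟨t, ht, hu.eventually hev⟩

/-- A dyadic locally uniform limit on `NonCoincident` is pointwise unique there: it agrees with any
full-filter limit of the same correlators. [folklore] -/
theorem dyadicLimit_eq_of_limit {Δ : ℝ} {n : ℕ} {Tn Sn : (Fin n → EuclideanSpace ℝ (Fin 3)) → ℝ}
    (hTn : TendstoLocallyUniformlyOn
      (fun k : ℕ => rescaledCorrelator (criticalCorr 3) (fun δ => δ ^ (-Δ)) n (((2:ℝ) ^ k)⁻¹)) Tn atTop
      (NonCoincident 3 n))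
    (hSn : TendstoLocallyUniformlyOn (rescaledCorrelator (criticalCorr 3) (fun δ => δ ^ (-Δ)) n) Sn
      (𝓝[>] (0 : ℝ)) (NonCoincident 3 n))
    {x : Fin n → EuclideanSpace ℝ (Fin 3)} (hx : x ∈ NonCoincident 3 n) : Tn x = Sn x :=
  tendsto_nhds_unique (hTn.tendsto_at hx) ((hSn.tendsto_at hx).comp tendsto_dyadicMesh)

/-! ### The regularised family built from dyadic data -/

/-- The regularised family (truncation of `T` off `NonCoincident` in the even arities `≥ 4`, zero
elsewhere) is translation invariant as soon as the even arities `≥ 4` of `T` are DYADIC canonical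
limits: translation invariance of sequential limits of `criticalCorr 3` is free
(`seqLimit_translate`); off `NonCoincident` and in the other arities both sides vanish. -/
theorem isTranslationInvariant_evenTruncate_of_dyadic {Δ : ℝ} {T : CorrFamily 3}
    (hT : ∀ n, 4 ≤ n → Even n → TendstoLocallyUniformlyOn
      (fun k : ℕ => rescaledCorrelator (criticalCorr 3) (fun δ => δ ^ (-Δ)) n (((2:ℝ) ^ k)⁻¹)) (T n)
      atTop (NonCoincident 3 n)) :
    IsTranslationInvariant (fun n x => if 4 ≤ n ∧ Even n then truncate T n x else 0) := by
  intro n v x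
  by_cases hn : 4 ≤ n ∧ Even n
  · simp only [if_pos hn]
    by_cases hx : x ∈ NonCoincident 3 n
    · have hxv : (fun i => x i + v) ∈ NonCoincident 3 n := (add_mem_nonCoincident_iff v x).2 hx
      rw [truncate_of_mem T hxv, truncate_of_mem T hx]
      exact seqLimit_translate tendsto_dyadicMesh (hT n hn.1 hn.2) v hx
    · have hxv : (fun i => x i + v) ∉ NonCoincident 3 n :=
        fun h => hx ((add_mem_nonCoincident_iff v x).1 h)
      rw [truncate_of_not_mem T hxv, truncate_of_not_mem T hx]
  · simp only [if_neg hn]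

/-- The regularised family is unit-inversion covariant with weight `Δ` as soon as the even arities
`≥ 4` of `T` are so at NON-COINCIDENT configurations off the origin (the unit inversion preserves
non-coincidence; elsewhere both sides vanish). -/
theorem isInversionCovariant_evenTruncate_of_nonCoincident {Δ : ℝ} {T : CorrFamily 3}
    (hi : ∀ n, 4 ≤ n → Even n → ∀ x ∈ NonCoincident 3 n, (∀ i, x i ≠ 0) →
      T n (fun i => inversion 0 1 (x i)) = (∏ i, ‖x i‖ ^ (2 * Δ)) * T n x) :
    IsInversionCovariant Δ (fun n x => if 4 ≤ n ∧ Even n then truncate T n x else 0) := by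
  intro n x h0
  by_cases hn : 4 ≤ n ∧ Even n
  · simp only [if_pos hn]
    by_cases hx : x ∈ NonCoincident 3 n
    · rw [truncate_of_mem T ((inversion_mem_nonCoincident_iff x).2 hx), truncate_of_mem T hx]
      exact hi n hn.1 hn.2 x hx h0
    · have hIx : (fun i => inversion 0 1 (x i)) ∉ NonCoincident 3 n :=
        fun h => hx ((inversion_mem_nonCoincident_iff x).1 h)
      rw [truncate_of_not_mem T hIx, truncate_of_not_mem T hx, mul_zero]
  · simp only [if_neg hn, mul_zero]

/-! ### The reduction: the crux ⇔ dyadic canonical convergence + unit-inversion covariance -/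

/-- **The crux ⇔ DYADIC existence + unit-inversion covariance of the even canonical limits.**
`MoebiusLimitOfTwoPointLaw` holds iff for every witness `(Δ, c)` of item 0634 there is a family `T`
such that for every EVEN `n ≥ 4`:
(a₂) `2^{knΔ}⟨σ_{[2^k x₁]}⋯σ_{[2^k xₙ]}⟩_{β_c} → T_n` locally uniformly off the diagonals as `k → ∞`
(the canonical renormalisation along the single mesh sequence `δ_k = 2^{-k}`), and
(c) `T_n (ι x) = (∏ᵢ ‖xᵢ‖^{2Δ}) T_n x` off the origin.
Proof of `←`: regularise `T` (truncate off `NonCoincident`, zero in the other arities); the result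
is translation invariant (`seqLimit_translate`) and inversion covariant, hence scale covariant
(`inversionBegetsDilations`), so Lemma A (`tendstoLocallyUniformlyOn_nhdsGT_of_dyadic`) upgrades the
dyadic convergence to the full filter, and p89954 (`…_iff_existence_and_inversion`, which already
makes `O(3)` from item 4675) concludes. -/
theorem moebiusLimitOfTwoPointLaw_iff_dyadic :
    MoebiusLimitOfTwoPointLaw ↔
      ∀ Δ c : ℝ, 0 < c →
        Tendsto (fun x : Site 3 =>
          criticalTwoPoint 3 x * Real.sqrt (∑ i, ((x i : ℝ)) ^ 2) ^ (2 * Δ)) cofinite (nhds c) →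
        ∃ T : CorrFamily 3,
          (∀ n, 4 ≤ n → Even n → TendstoLocallyUniformlyOn
            (fun k : ℕ => rescaledCorrelator (criticalCorr 3) (fun δ => δ ^ (-Δ)) n (((2:ℝ) ^ k)⁻¹))
            (T n) atTop (NonCoincident 3 n)) ∧
          (∀ n, 4 ≤ n → Even n → ∀ x : Fin n → EuclideanSpace ℝ (Fin 3), (∀ i, x i ≠ 0) →
            T n (fun i => inversion 0 1 (x i)) = (∏ i, ‖x i‖ ^ (2 * Δ)) * T n x) := by
  rw [moebiusLimitOfTwoPointLaw_iff_existence_and_inversion]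
  constructor
  · intro h Δ c hc hP
    obtain ⟨T, hT, hi⟩ := h Δ c hc hP
    exact ⟨T, fun n h4 he => tendstoLocallyUniformlyOn_comp_seq (hT n h4 he) tendsto_dyadicMesh, hi⟩
  · intro h Δ c hc hP
    obtain ⟨T, hd, hi⟩ := h Δ c hc hP
    -- the regularised family
    have htr := isTranslationInvariant_evenTruncate_of_dyadic hd
    have hinv : IsInversionCovariant Δ (fun n x => if 4 ≤ n ∧ Even n then truncate T n x else 0) :=
      isInversionCovariant_evenTruncate_of_nonCoincident fun n h4 he x _ h0 => hi n h4 he x h0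
    -- Lemma B: translations + unit inversion give every dilation
    have hsc : IsScaleCovariant Δ (fun n x => if 4 ≤ n ∧ Even n then truncate T n x else 0) :=
      inversionBegetsDilations Δ _ htr hinv
    refine ⟨fun n x => if 4 ≤ n ∧ Even n then truncate T n x else 0, ?_, ?_⟩
    · intro n h4 he
      -- dyadic convergence to the regularised family …
      have hd' : TendstoLocallyUniformlyOn
          (fun k : ℕ => rescaledCorrelator (criticalCorr 3) (fun δ => δ ^ (-Δ)) n (((2:ℝ) ^ k)⁻¹))
          (fun x => if 4 ≤ n ∧ Even n then truncate T n x else 0) atTop (NonCoincident 3 n) := by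
        refine (hd n h4 he).congr_right fun x hx => ?_
        show T n x = if 4 ≤ n ∧ Even n then truncate T n x else 0
        rw [if_pos ⟨h4, he⟩, truncate_of_mem T hx]
      -- … and Lemma A: dyadic + dilation covariance ⇒ the full filter
      exact tendstoLocallyUniformlyOn_nhdsGT_of_dyadic (criticalCorr 3) Δ n _ hd'
        (fun c' hc' x => hsc n c' hc' x)
    · intro n _ _ x h0
      exact hinv n x h0

/-- The same reduction under the second host route's spelling of the crux
(`Theses.BernsteinTemperature`, identical definiens). -/
theorem moebiusLimitOfTwoPointLaw_iff_dyadic' :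
    Theses.BernsteinTemperature.MoebiusLimitOfTwoPointLaw ↔
      ∀ Δ c : ℝ, 0 < c →
        Tendsto (fun x : Site 3 =>
          criticalTwoPoint 3 x * Real.sqrt (∑ i, ((x i : ℝ)) ^ 2) ^ (2 * Δ)) cofinite (nhds c) →
        ∃ T : CorrFamily 3,
          (∀ n, 4 ≤ n → Even n → TendstoLocallyUniformlyOn
            (fun k : ℕ => rescaledCorrelator (criticalCorr 3) (fun δ => δ ^ (-Δ)) n (((2:ℝ) ^ k)⁻¹))
            (T n) atTop (NonCoincident 3 n)) ∧
          (∀ n, 4 ≤ n → Even n → ∀ x : Fin n → EuclideanSpace ℝ (Fin 3), (∀ i, x i ≠ 0) →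
            T n (fun i => inversion 0 1 (x i)) = (∏ i, ‖x i‖ ^ (2 * Δ)) * T n x) :=
  moebiusLimitOfTwoPointLaw_iff_dyadic

/-! ### The two-factor split `crux ↔ D₂ ∧ I₂` -/

/-- **Glue of the line** (`MoebiusLimitOfTwoPointLaw_of`): `D₂ → I₂ → crux`, where
`D₂` = for every witness `(Δ,c)` of item 0634 and every even `n ≥ 4`, the canonically renormalised
`n`-point correlators converge locally uniformly off the diagonals along `δ_k = 2^{-k}` to SOME `Tₙ`;
`I₂` = for every such `(Δ,c)`, `n` and EVERY such dyadic limit `Tₙ`, `Tₙ (ι x) = (∏ᵢ ‖xᵢ‖^{2Δ}) Tₙ x`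
at non-coincident `x` off the origin. (Assemble the chosen limits into one family, truncate off
`NonCoincident`, apply `moebiusLimitOfTwoPointLaw_iff_dyadic`.) -/
theorem moebiusLimitOfTwoPointLaw_of_dyadic :
    (∀ Δ c : ℝ, 0 < c →
      Tendsto (fun x : Site 3 =>
        criticalTwoPoint 3 x * Real.sqrt (∑ i, ((x i : ℝ)) ^ 2) ^ (2 * Δ)) cofinite (nhds c) →
      ∀ n, 4 ≤ n → Even n → ∃ Tn : (Fin n → EuclideanSpace ℝ (Fin 3)) → ℝ,
        TendstoLocallyUniformlyOn
          (fun k : ℕ => rescaledCorrelator (criticalCorr 3) (fun δ => δ ^ (-Δ)) n (((2:ℝ) ^ k)⁻¹))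
          Tn atTop (NonCoincident 3 n)) →
    (∀ Δ c : ℝ, 0 < c →
      Tendsto (fun x : Site 3 =>
        criticalTwoPoint 3 x * Real.sqrt (∑ i, ((x i : ℝ)) ^ 2) ^ (2 * Δ)) cofinite (nhds c) →
      ∀ n, 4 ≤ n → Even n → ∀ Tn : (Fin n → EuclideanSpace ℝ (Fin 3)) → ℝ,
        TendstoLocallyUniformlyOn
          (fun k : ℕ => rescaledCorrelator (criticalCorr 3) (fun δ => δ ^ (-Δ)) n (((2:ℝ) ^ k)⁻¹))
          Tn atTop (NonCoincident 3 n) →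
        ∀ x ∈ NonCoincident 3 n, (∀ i, x i ≠ 0) →
          Tn (fun i => inversion 0 1 (x i)) = (∏ i, ‖x i‖ ^ (2 * Δ)) * Tn x) →
    MoebiusLimitOfTwoPointLaw := by
  intro hD hI
  rw [moebiusLimitOfTwoPointLaw_iff_dyadic]
  intro Δ c hc hP
  have hD' := hD Δ c hc hP
  -- one family assembled from the chosen dyadic limits (junk `0` in the other arities)
  set T : CorrFamily 3 := fun n x =>
    if h : 4 ≤ n ∧ Even n then (hD' n h.1 h.2).choose x else 0 with hT
  have hTconv : ∀ n, 4 ≤ n → Even n → TendstoLocallyUniformlyOn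
      (fun k : ℕ => rescaledCorrelator (criticalCorr 3) (fun δ => δ ^ (-Δ)) n (((2:ℝ) ^ k)⁻¹))
      (T n) atTop (NonCoincident 3 n) := by
    intro n h4 he
    have hspec := (hD' n h4 he).choose_spec
    have hTn : T n = (hD' n h4 he).choose := by
      funext x
      simp only [hT, dif_pos (And.intro h4 he)]
    rw [hTn]
    exact hspec
  refine ⟨truncate T, ?_, ?_⟩
  · intro n h4 he
    exact (hTconv n h4 he).congr_right fun x hx => (truncate_of_mem T hx).symm
  · intro n h4 he x h0
    by_cases hx : x ∈ NonCoincident 3 n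
    · rw [truncate_of_mem T ((inversion_mem_nonCoincident_iff x).2 hx), truncate_of_mem T hx]
      exact hI Δ c hc hP n h4 he (T n) (hTconv n h4 he) x hx h0
    · have hIx : (fun i => inversion 0 1 (x i)) ∉ NonCoincident 3 n :=
        fun h => hx ((inversion_mem_nonCoincident_iff x).1 h)
      rw [truncate_of_not_mem T hIx, truncate_of_not_mem T hx, mul_zero]

/-- **`crux → D₂`**: the crux gives dyadic canonical limits of every even arity `n ≥ 4`. -/
theorem dyadicLimit_of_moebiusLimitOfTwoPointLaw :
    MoebiusLimitOfTwoPointLaw →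
    ∀ Δ c : ℝ, 0 < c →
      Tendsto (fun x : Site 3 =>
        criticalTwoPoint 3 x * Real.sqrt (∑ i, ((x i : ℝ)) ^ 2) ^ (2 * Δ)) cofinite (nhds c) →
      ∀ n, 4 ≤ n → Even n → ∃ Tn : (Fin n → EuclideanSpace ℝ (Fin 3)) → ℝ,
        TendstoLocallyUniformlyOn
          (fun k : ℕ => rescaledCorrelator (criticalCorr 3) (fun δ => δ ^ (-Δ)) n (((2:ℝ) ^ k)⁻¹))
          Tn atTop (NonCoincident 3 n) := by
  intro h Δ c hc hP n h4 he
  obtain ⟨T, hT, -⟩ := moebiusLimitOfTwoPointLaw_iff_dyadic.1 h Δ c hc hP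
  exact ⟨T n, hT n h4 he⟩

/-- **`crux → I₂`**: under the crux, EVERY dyadic canonical limit of an even arity `n ≥ 4` is
unit-inversion covariant with weight `Δ` at non-coincident configurations off the origin — it
agrees there with the full-filter Möbius limit (`dyadicLimit_eq_of_limit`), and the unit inversion
preserves non-coincidence. -/
theorem dyadicInversion_of_moebiusLimitOfTwoPointLaw :
    MoebiusLimitOfTwoPointLaw →
    ∀ Δ c : ℝ, 0 < c →
      Tendsto (fun x : Site 3 =>
        criticalTwoPoint 3 x * Real.sqrt (∑ i, ((x i : ℝ)) ^ 2) ^ (2 * Δ)) cofinite (nhds c) →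
      ∀ n, 4 ≤ n → Even n → ∀ Tn : (Fin n → EuclideanSpace ℝ (Fin 3)) → ℝ,
        TendstoLocallyUniformlyOn
          (fun k : ℕ => rescaledCorrelator (criticalCorr 3) (fun δ => δ ^ (-Δ)) n (((2:ℝ) ^ k)⁻¹))
          Tn atTop (NonCoincident 3 n) →
        ∀ x ∈ NonCoincident 3 n, (∀ i, x i ≠ 0) →
          Tn (fun i => inversion 0 1 (x i)) = (∏ i, ‖x i‖ ^ (2 * Δ)) * Tn x := by
  intro h Δ c hc hP n h4 he Tn hTn x hx h0
  obtain ⟨T, hT, hi⟩ := moebiusLimitOfTwoPointLaw_iff_existence_and_inversion.1 h Δ c hc hP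
  have hιx : (fun i => inversion 0 1 (x i)) ∈ NonCoincident 3 n :=
    (inversion_mem_nonCoincident_iff x).2 hx
  rw [dyadicLimit_eq_of_limit hTn (hT n h4 he) hιx, dyadicLimit_eq_of_limit hTn (hT n h4 he) hx]
  exact hi n h4 he x h0

/-- **Exact two-factor factorisation of the crux: `crux ↔ D₂ ∧ I₂`.** Next to the landed
three-factor residue `crux ↔ (0634 → 4738 ∧ 8367 ∧ 1982)` (p117654) this one has no `O(3)`
factor and asks existence only along the dyadic mesh sequence with the canonical
renormalisation; both factors are consequences of the crux, so nothing is lost. -/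
theorem moebiusLimitOfTwoPointLaw_iff_dyadicLimit_and_dyadicInversion :
    MoebiusLimitOfTwoPointLaw ↔
      (∀ Δ c : ℝ, 0 < c →
        Tendsto (fun x : Site 3 =>
          criticalTwoPoint 3 x * Real.sqrt (∑ i, ((x i : ℝ)) ^ 2) ^ (2 * Δ)) cofinite (nhds c) →
        ∀ n, 4 ≤ n → Even n → ∃ Tn : (Fin n → EuclideanSpace ℝ (Fin 3)) → ℝ,
          TendstoLocallyUniformlyOn
            (fun k : ℕ => rescaledCorrelator (criticalCorr 3) (fun δ => δ ^ (-Δ)) n (((2:ℝ) ^ k)⁻¹))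
            Tn atTop (NonCoincident 3 n)) ∧
      (∀ Δ c : ℝ, 0 < c →
        Tendsto (fun x : Site 3 =>
          criticalTwoPoint 3 x * Real.sqrt (∑ i, ((x i : ℝ)) ^ 2) ^ (2 * Δ)) cofinite (nhds c) →
        ∀ n, 4 ≤ n → Even n → ∀ Tn : (Fin n → EuclideanSpace ℝ (Fin 3)) → ℝ,
          TendstoLocallyUniformlyOn
            (fun k : ℕ => rescaledCorrelator (criticalCorr 3) (fun δ => δ ^ (-Δ)) n (((2:ℝ) ^ k)⁻¹))
            Tn atTop (NonCoincident 3 n) →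
          ∀ x ∈ NonCoincident 3 n, (∀ i, x i ≠ 0) →
            Tn (fun i => inversion 0 1 (x i)) = (∏ i, ‖x i‖ ^ (2 * Δ)) * Tn x) :=
  ⟨fun h => ⟨dyadicLimit_of_moebiusLimitOfTwoPointLaw h, dyadicInversion_of_moebiusLimitOfTwoPointLaw h⟩,
    fun h => moebiusLimitOfTwoPointLaw_of_dyadic h.1 h.2⟩

/-- The glue under the second host route's spelling (`Theses.BernsteinTemperature`, identical
definiens): `D₂ → I₂ → BernsteinTemperature.MoebiusLimitOfTwoPointLaw`. -/
theorem moebiusLimitOfTwoPointLaw_of_dyadic' :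
    (∀ Δ c : ℝ, 0 < c →
      Tendsto (fun x : Site 3 =>
        criticalTwoPoint 3 x * Real.sqrt (∑ i, ((x i : ℝ)) ^ 2) ^ (2 * Δ)) cofinite (nhds c) →
      ∀ n, 4 ≤ n → Even n → ∃ Tn : (Fin n → EuclideanSpace ℝ (Fin 3)) → ℝ,
        TendstoLocallyUniformlyOn
          (fun k : ℕ => rescaledCorrelator (criticalCorr 3) (fun δ => δ ^ (-Δ)) n (((2:ℝ) ^ k)⁻¹))
          Tn atTop (NonCoincident 3 n)) →
    (∀ Δ c : ℝ, 0 < c →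
      Tendsto (fun x : Site 3 =>
        criticalTwoPoint 3 x * Real.sqrt (∑ i, ((x i : ℝ)) ^ 2) ^ (2 * Δ)) cofinite (nhds c) →
      ∀ n, 4 ≤ n → Even n → ∀ Tn : (Fin n → EuclideanSpace ℝ (Fin 3)) → ℝ,
        TendstoLocallyUniformlyOn
          (fun k : ℕ => rescaledCorrelator (criticalCorr 3) (fun δ => δ ^ (-Δ)) n (((2:ℝ) ^ k)⁻¹))
          Tn atTop (NonCoincident 3 n) →
        ∀ x ∈ NonCoincident 3 n, (∀ i, x i ≠ 0) →
          Tn (fun i => inversion 0 1 (x i)) = (∏ i, ‖x i‖ ^ (2 * Δ)) * Tn x) →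
    Theses.BernsteinTemperature.MoebiusLimitOfTwoPointLaw :=
  moebiusLimitOfTwoPointLaw_of_dyadic

end Summit.CriticalPhenomena.Ising3DConformalLimit.PrecisionLaplacianMoebiusLimitOfTwoPointLaw

end
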